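import Summits.BirchSwinnertonDyer.BirchSwinnertonDyer.Theorems.CMKolyvaginAtInertTwoAdaptiveSplitting
import HarnessLib

/-!
# Route `CMKolyvaginAtInertTwo`, crux `CMKolyvaginExactAtInertTwo` (stmt-BirchSwinnertonDyer-24277):
# THE ADAPTIVE STEP OF McCALLUM'S THM. 5.4 AT `2`, PACKAGED for the split-form telescope

Seat `bsd-line-cmk2-p1` g12 (cell `bsd-print-cf2`); helper (`--supports stmt-BirchSwinnertonDyer-24277`).
THEOREMS ONLY: no definition, no named fact, no `sorry`; no item is closed; BSD is not proved by this.
Sequel of `…AdaptiveSplitting` (p668236: STEP LEMMA `exists_isCompl_zmultiples_not_mem`, and the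
`p = 2` realisability criterion `exists_characters_of_bottom_ne_add`); memo
`Cruxes/CMExactDescentAtTwo/MEMO-T5-adaptive-splitting.md` §3.

WHAT. The split-form telescope of the tree (`SplitHypothesesM.exists_chain_of_casselsTate_pure`,
McCallum (16)–(23) with the lifts `s_i` FIXED) consumes a Čebotarev binder `hCeb` that is false at
`2`; the memo's repair is to weaken the binder to the bottoms criterion and to choose the next
generator and the complement of the remaining lift group ADAPTIVELY. This file is the group-theoretic
step in exactly the shape that port needs:

* `exists_split_not_mem_sup` — in an abelian group `G` (read: bottoms, i.e. `H¹(K, E[2^M])[2]`,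
  or `V[2]` modulo `Δ_H`), for a finite non-trivial `Z ≤ G` (remaining lift group of the ACTIVE side)
  DISJOINT from `Y ≤ G` (remaining bottoms of the PASSIVE side — the invariant `I = 0`, memo 3.4)
  and `β ∉ Y` (the bottom of `c(n_k)`; memo (F1): Cassels–Tate orthogonality), there are `z ∈ Z` of
  order `exp Z` (the next generator `c_{k+1}`, of maximal order) and `Z′ ≤ Z` with `Z = ⟨z⟩ ⊕ Z′`,
  `Z′` disjoint from `Y`, **`β ∉ Z′ ⊔ Y`** and **no non-zero multiple of `z` in `Z′ ⊔ Y`** — so, by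
  the criterion, McCallum's prescription "(21) `c(n_k)` full, (22) `c_{k+1}` full, (23) the rest zero"
  at the next Kolyvagin prime is realisable, and the invariant passes to `(Z′, Y)`.

References: [McCallumLMS1991] §5 Thm. 5.4 (proof, (19)–(23), PDF pp. 288–289); [Hungerford1974]
Ch. II §2 Exercise 2.
-/

-- single-conjunct summit: `Summit.BirchSwinnertonDyer.BirchSwinnertonDyer.…` repeats the name by design
set_option linter.dupNamespace false
set_option autoImplicit false

namespace Summit.BirchSwinnertonDyer.BirchSwinnertonDyer.Theorems.KolyvaginAdaptiveTwo

open Literature.GroupTheory.FiniteAbelian Literature.NumberTheory.GaloisRepresentations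

/-! ## The packaged adaptive step (memo §3.2–3.4): active lift group `Z`, passive bottoms `Y` -/

section Packaged

variable {G : Type*} [AddCommGroup G]

/-- **THE ADAPTIVE STEP OF THM. 5.4 AT `2`, PACKAGED (memo §3: (F2) + STEP LEMMA + the invariant
`I = 0`).** In an ambient abelian group `G` (read: `V[2]`-bottoms modulo `Δ_H`, or `H¹(K, E[2^M])`)
let `Z ≤ G` be a finite non-trivial subgroup (the remaining lift group of the ACTIVE side) and
`Y ≤ G` a subgroup DISJOINT from it (the remaining bottoms of the PASSIVE side; disjointness is the
invariant `I = 0` of memo 3.4), and let `β ∉ Y` (the bottom of `c(n_k)`: memo (F1), Cassels–Tate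
orthogonality). Then `Z` splits as `⟨z⟩ ⊕ Z′` with `z ∈ Z` of order `exp Z` (the new generator
`c_{k+1}`) such that NEITHER `β` NOR ANY NON-ZERO MULTIPLE OF `z` lies in `Z′ ⊔ Y` — i.e. by the
`p = 2` criterion (`exists_characters_of_bottom_ne_add`) McCallum's prescription (21)–(23) at the
next Kolyvagin prime ("`c(n_k)`, `c_{k+1}` full; `Z′` and `Y` zero") is REALISABLE, and the new
passive/active pair `(Z′, Y-block)` is again disjoint. [cite: McCallumLMS1991, §5 Thm. 5.4 (proof, (19)–(23), PDF pp. 288–289)]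
[cite: Hungerford1974, Ch. II §2 Exercise 2 (PDF p. 141)] -/
theorem exists_split_not_mem_sup (Z Y : AddSubgroup G) [Finite Z] (hZ : Z ≠ ⊥)
    (hdisj : Disjoint Z Y) {β : G} (hβ : β ∉ Y) :
    ∃ z ∈ Z, addOrderOf z = AddMonoid.exponent Z ∧
      ∃ Z' : AddSubgroup G, Z' ≤ Z ∧ AddSubgroup.zmultiples z ⊓ Z' = ⊥ ∧
        AddSubgroup.zmultiples z ⊔ Z' = Z ∧ Disjoint Z' Y ∧ β ∉ Z' ⊔ Y ∧
        ∀ m : ℤ, m • z ≠ 0 → m • z ∉ Z' ⊔ Y := by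
  classical
  -- the element of `Z` to be avoided: the `Z`-component `t₀` of `β` if `β ∈ Z ⊔ Y`, else anything
  have hex : ∃ t : Z, t ≠ 0 ∧ (β ∈ Z ⊔ Y → ∃ y ∈ Y, β = (t : G) + y) := by
    by_cases hβZY : β ∈ Z ⊔ Y
    · obtain ⟨t, ht, y, hy, hty⟩ := AddSubgroup.mem_sup.1 hβZY
      refine ⟨⟨t, ht⟩, fun h ↦ hβ ?_, fun _ ↦ ⟨y, hy, hty.symm⟩⟩
      have : t = 0 := congrArg Subtype.val h
      rw [this, zero_add] at hty
      exact hty ▸ hy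
    · obtain ⟨t, ht⟩ := (AddSubgroup.ne_bot_iff_exists_ne_zero.1 hZ)
      exact ⟨t, ht, fun h ↦ (hβZY h).elim⟩
  obtain ⟨t, ht0, htβ⟩ := hex
  -- the step lemma inside `Z`
  obtain ⟨z, hz, H, hH, htH⟩ := exists_isCompl_zmultiples_not_mem (G := Z) ht0
  refine ⟨z, z.2, ?_, H.map Z.subtype, ?_, ?_, ?_, ?_, ?_, ?_⟩
  · rw [← hz]
    exact AddSubgroup.addOrderOf_coe z
  · exact AddSubgroup.map_subtype_le _
  · -- `⟨z⟩ ⊓ Z′ = ⊥`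
    rw [eq_bot_iff]
    rintro g ⟨hgz, hgH⟩
    obtain ⟨h, hh, rfl⟩ := AddSubgroup.mem_map.1 hgH
    obtain ⟨m, hm⟩ := AddSubgroup.mem_zmultiples_iff.1 hgz
    have hmem : (h : Z) ∈ AddSubgroup.zmultiples z := by
      refine AddSubgroup.mem_zmultiples_iff.2 ⟨m, Subtype.ext ?_⟩
      rw [AddSubgroupClass.coe_zsmul]
      exact hm
    have h0 : h = 0 := (AddSubgroup.disjoint_def.1 hH.disjoint) hmem hh
    rw [AddSubgroup.mem_bot, h0]
    rfl
  · -- `⟨z⟩ ⊔ Z′ = Z`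
    apply le_antisymm
    · refine sup_le ?_ (AddSubgroup.map_subtype_le _)
      exact (AddSubgroup.zmultiples_le_of_mem z.2)
    · intro g hg
      have hg' : (⟨g, hg⟩ : Z) ∈ AddSubgroup.zmultiples z ⊔ H :=
        hH.codisjoint.eq_top ▸ AddSubgroup.mem_top _
      obtain ⟨a, ha, b, hb, hab⟩ := AddSubgroup.mem_sup.1 hg'
      obtain ⟨m, rfl⟩ := AddSubgroup.mem_zmultiples_iff.1 ha
      refine AddSubgroup.mem_sup.2 ⟨m • (z : G), AddSubgroup.mem_zmultiples_iff.2 ⟨m, rfl⟩, (b : G),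
        AddSubgroup.mem_map.2 ⟨b, hb, rfl⟩, ?_⟩
      have := congrArg Subtype.val hab
      rwa [AddSubgroup.coe_add, AddSubgroupClass.coe_zsmul] at this
  · -- `Z′` disjoint from `Y`
    exact hdisj.mono_left (AddSubgroup.map_subtype_le _)
  · -- `β ∉ Z′ ⊔ Y`
    intro hβ'
    have hβZY : β ∈ Z ⊔ Y := (sup_le_sup_right (AddSubgroup.map_subtype_le H) Y) hβ'
    obtain ⟨y, hy, hβty⟩ := htβ hβZY
    obtain ⟨g, hg, y', hy', hgy⟩ := AddSubgroup.mem_sup.1 hβ'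
    obtain ⟨h, hh, rfl⟩ := AddSubgroup.mem_map.1 hg
    -- uniqueness of the decomposition in `Z ⊕ Y`: `h = t`
    rw [AddSubgroup.coe_subtype] at hgy
    have hdiff : (t : G) - (h : G) = y' - y := by
      have e1 : (t : G) + y = (h : G) + y' := by rw [← hβty, hgy]
      have e2 : (t : G) - (h : G) - (y' - y) = ((t : G) + y) - ((h : G) + y') := by abel
      rw [← sub_eq_zero, e2, e1, sub_self]
    have hZmem : (t : G) - (h : G) ∈ Z := Z.sub_mem t.2 h.2
    have hYmem : (t : G) - (h : G) ∈ Y := hdiff ▸ Y.sub_mem hy' hy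
    have h0 : (t : G) - (h : G) = 0 := (AddSubgroup.disjoint_def.1 hdisj) hZmem hYmem
    have hth : t = h := Subtype.ext (sub_eq_zero.1 h0)
    exact htH (hth ▸ hh)
  · -- non-zero multiples of `z` avoid `Z′ ⊔ Y`
    intro m hm hmem
    obtain ⟨g, hg, y', hy', hgy⟩ := AddSubgroup.mem_sup.1 hmem
    obtain ⟨h, hh, rfl⟩ := AddSubgroup.mem_map.1 hg
    rw [AddSubgroup.coe_subtype] at hgy
    have hYmem : m • (z : G) - (h : G) ∈ Y := by
      rw [← hgy, add_sub_cancel_left]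
      exact hy'
    have hZmem : m • (z : G) - (h : G) ∈ Z := Z.sub_mem (Z.zsmul_mem z.2 m) h.2
    have h0 : m • (z : G) - (h : G) = 0 := (AddSubgroup.disjoint_def.1 hdisj) hZmem hYmem
    have hzh : m • z = h := Subtype.ext (by rw [AddSubgroupClass.coe_zsmul]; exact sub_eq_zero.1 h0)
    have hmem' : m • z ∈ AddSubgroup.zmultiples z ⊓ H :=
      ⟨AddSubgroup.mem_zmultiples_iff.2 ⟨m, rfl⟩, hzh ▸ hh⟩
    rw [hH.inf_eq_bot, AddSubgroup.mem_bot] at hmem'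
    apply hm
    have := congrArg Subtype.val hmem'
    rwa [AddSubgroupClass.coe_zsmul] at this

end Packaged

/-! ## The `p = 2` criterion in RELATIVE (order ≥ `2^I`) form — the shape the split telescope
consumes at a slack step (invariant (I) gives a LOWER BOUND `I_k` on the local order of `c(n_k)`,
not its full order) -/

section Relative

variable {C : Type*} [AddCommGroup C]

/-- **Cor. 3.2 at `2`, relative form, NECESSITY.** If `χ₊ = ψ₁ + ψ₂` kills `Zp`, `χ₋ = ψ₁ - ψ₂`
kills `Zm` and `χ₊(c) ≠ 0`, then `c ∉ Zp + Zm[2]` (`c` is not `u + v` with `u ∈ Zp`, `v ∈ Zm`,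
`2v = 0`). Applied to `c = 2^{I-1} c(n_k)`: the telescope's requirement "`ord c(n_k)_λ ≥ 2^{I}`"
together with "pool zero" forces `2^{I-1} c(n_k) ∉ pool_ν + pool_{-ν}[2]`.
[cite: McCallumLMS1991, §3 Cor. 3.2; §5 Thm. 5.4 (21), (23)] -/
theorem not_mem_add_of_characters_apply_ne_zero {M : ℕ} {Zp Zm : AddSubgroup C} {c : C}
    (ψ₁ ψ₂ : C →+ ZMod (2 ^ M)) (hp : ∀ u ∈ Zp, ψ₁ u + ψ₂ u = 0)
    (hm0 : ∀ v ∈ Zm, ψ₁ v - ψ₂ v = 0) (hc : ψ₁ c + ψ₂ c ≠ 0) :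
    ∀ u ∈ Zp, ∀ v ∈ Zm, 2 • v = 0 → c ≠ u + v := by
  intro u hu v hv h2v hcuv
  apply hc
  rw [hcuv, map_add, map_add, add_add_add_comm, hp u hu, zero_add]
  have : ψ₁ v + ψ₂ v = (ψ₁ v - ψ₂ v) + ψ₂ (2 • v) := by
    rw [map_nsmul, two_nsmul]
    abel
  rw [this, hm0 v hv, h2v, map_zero, add_zero]

/-- **Cor. 3.2 at `2`, relative form, SUFFICIENCY.** Let `C` be a finite abelian group killed by
`2^M`, `Zp, Zm ≤ C`, `c ∈ C` with `c ∉ Zp + Zm[2]`, and `b ≠ 0` whose bottom `(ord b / 2) • b` is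
not in `Zp[2] + Zm[2]`. Then there are `ψ₁, ψ₂ : C → ℤ/2^M` with `ψ₁ + ψ₂` killing `Zp`,
`ψ₁ - ψ₂` killing `Zm`, **`(ψ₁ + ψ₂)(c) ≠ 0`** and `ord (ψ₁ - ψ₂)(b) = ord b`. With `c = 2^{I-1} g₂`
this realises "`ord g_{2,λ} ≥ 2^I`, `g_{1,λ}` full, pool zero" — the order-form Čebotarev binder
`hCeb₂` of the adaptive telescope (crux workfile `T4_SPEC_adaptive_telescope.lean`). Same proof as
`exists_characters_of_bottom_ne_add` (characters of `(C × C)/({(u,u)} + {(v,-v)})`).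
[cite: McCallumLMS1991, §3 Prop. 3.1, Cor. 3.2; §5 Thm. 5.4 (21)–(23)] -/
theorem exists_characters_of_not_mem_add [Finite C] {M : ℕ} (hC : ∀ x : C, 2 ^ M • x = 0)
    (Zp Zm : AddSubgroup C) {c b : C} (hb : b ≠ 0)
    (hcA : ∀ u ∈ Zp, ∀ v ∈ Zm, 2 • v = 0 → c ≠ u + v)
    (hB : ∀ u ∈ Zp, ∀ v ∈ Zm, 2 • u = 0 → 2 • v = 0 → (addOrderOf b / 2) • b ≠ u + v) :
    ∃ ψ₁ ψ₂ : C →+ ZMod (2 ^ M),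
      (∀ u ∈ Zp, ψ₁ u + ψ₂ u = 0) ∧ (∀ v ∈ Zm, ψ₁ v - ψ₂ v = 0) ∧
      ψ₁ c + ψ₂ c ≠ 0 ∧ addOrderOf (ψ₁ b - ψ₂ b) = addOrderOf b := by
  classical
  haveI : NeZero (2 ^ M) := ⟨pow_ne_zero _ two_ne_zero⟩
  obtain ⟨f, hbf, hdivb⟩ := exists_addOrderOf_eq_two_pow_succ hC hb
  set β : C := 2 ^ f • b with hβ
  have h2β : 2 • β = 0 := by
    rw [hβ, ← mul_nsmul, ← pow_succ, ← hbf]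
    exact addOrderOf_nsmul_eq_zero b
  rw [hdivb] at hB
  -- the subgroup `N = {(u,u)} + {(v,-v)}` of `C × C`
  set dg : C →+ C × C := (AddMonoidHom.id C).prod (AddMonoidHom.id C) with hdg
  set ad : C →+ C × C := (AddMonoidHom.id C).prod (-AddMonoidHom.id C) with had
  set N : AddSubgroup (C × C) := Zp.map dg ⊔ Zm.map ad with hN
  have hmemN : ∀ x : C × C, x ∈ N → ∃ u ∈ Zp, ∃ v ∈ Zm, x = (u + v, u - v) := by
    intro x hx
    obtain ⟨y, hy, z, hz, rfl⟩ := AddSubgroup.mem_sup.1 hx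
    obtain ⟨u, hu, rfl⟩ := AddSubgroup.mem_map.1 hy
    obtain ⟨v, hv, rfl⟩ := AddSubgroup.mem_map.1 hz
    refine ⟨u, hu, v, hv, ?_⟩
    simp only [hdg, had, AddMonoidHom.prod_apply, AddMonoidHom.id_apply, AddMonoidHom.neg_apply,
      Prod.mk_add_mk, sub_eq_add_neg]
  have hcN : ((c, c) : C × C) ∉ N := by
    intro h
    obtain ⟨u, hu, v, hv, huv⟩ := hmemN _ h
    obtain ⟨h1, h2⟩ := Prod.mk.inj huv
    have h2v : 2 • v = 0 := by
      have : u + v = u - v := h1.symm.trans h2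
      rw [two_nsmul]
      have := sub_eq_zero.2 this
      rw [show u + v - (u - v) = v + v by abel] at this
      exact this
    exact hcA u hu v hv h2v h1
  have hβN : ((β, -β) : C × C) ∉ N := by
    intro h
    obtain ⟨u, hu, v, hv, huv⟩ := hmemN _ h
    obtain ⟨h1, h2⟩ := Prod.mk.inj huv
    have h2u : 2 • u = 0 := by
      have : β + -β = (u + v) + (u - v) := by rw [← h1, ← h2]
      rw [add_neg_cancel] at this
      rw [two_nsmul]
      have e2 : u + v + (u - v) = u + u := by abel
      rw [e2] at this
      exact this.symm
    have h2v : 2 • v = 0 := by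
      have : 2 • (u + v) = 0 := by rw [← h1]; exact h2β
      rwa [nsmul_add, h2u, zero_add] at this
    exact hB u hu v hv h2u h2v h1
  -- characters of `(C × C)/N` separating the two classes
  have hQ : ∀ q : (C × C) ⧸ N, (2 ^ M) • q = 0 := by
    intro q
    induction q using QuotientAddGroup.induction_on with
    | H y =>
      rw [← QuotientAddGroup.mk_nsmul, Prod.smul_mk, hC, hC, Prod.mk_zero_zero,
        QuotientAddGroup.mk_zero]
  have hqc : (QuotientAddGroup.mk ((c, c) : C × C) : (C × C) ⧸ N) ≠ 0 := fun h ↦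
    hcN ((QuotientAddGroup.eq_zero_iff _).1 h)
  have hqb : (QuotientAddGroup.mk ((β, -β) : C × C) : (C × C) ⧸ N) ≠ 0 := fun h ↦
    hβN ((QuotientAddGroup.eq_zero_iff _).1 h)
  obtain ⟨φa, hφa⟩ := exists_addMonoidHom_zmod_apply_ne_zero hQ hqc
  obtain ⟨φb, hφb⟩ := exists_addMonoidHom_zmod_apply_ne_zero hQ hqb
  obtain ⟨Φ, hΦa, hΦb⟩ : ∃ Φ : (C × C) ⧸ N →+ ZMod (2 ^ M),
      Φ (QuotientAddGroup.mk (c, c)) ≠ 0 ∧ Φ (QuotientAddGroup.mk (β, -β)) ≠ 0 := by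
    by_cases h1 : φa (QuotientAddGroup.mk (β, -β)) ≠ 0
    · exact ⟨φa, hφa, h1⟩
    by_cases h2 : φb (QuotientAddGroup.mk (c, c)) ≠ 0
    · exact ⟨φb, h2, hφb⟩
    push Not at h1 h2
    refine ⟨φa + φb, ?_, ?_⟩
    · rw [AddMonoidHom.add_apply, h2, add_zero]; exact hφa
    · rw [AddMonoidHom.add_apply, h1, zero_add]; exact hφb
  set Ψ : C × C →+ ZMod (2 ^ M) := Φ.comp (QuotientAddGroup.mk' N) with hΨ
  have hΨN : ∀ x ∈ N, Ψ x = 0 := fun x hx ↦ by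
    rw [hΨ, AddMonoidHom.comp_apply, QuotientAddGroup.mk'_apply,
      (QuotientAddGroup.eq_zero_iff x).2 hx, map_zero]
  have hΨc : Ψ (c, c) ≠ 0 := by
    rw [hΨ, AddMonoidHom.comp_apply, QuotientAddGroup.mk'_apply]
    exact hΦa
  have hΨb : Ψ (β, -β) ≠ 0 := by
    rw [hΨ, AddMonoidHom.comp_apply, QuotientAddGroup.mk'_apply]
    exact hΦb
  clear_value Ψ
  refine ⟨Ψ.comp (AddMonoidHom.inl C C), Ψ.comp (AddMonoidHom.inr C C), ?_, ?_, ?_, ?_⟩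
  · intro u hu
    change Ψ (u, 0) + Ψ (0, u) = 0
    rw [← map_add, Prod.mk_add_mk, add_zero, zero_add]
    exact hΨN _ (AddSubgroup.mem_sup_left (AddSubgroup.mem_map.2 ⟨u, hu, rfl⟩))
  · intro v hv
    change Ψ (v, 0) - Ψ (0, v) = 0
    rw [← map_sub, Prod.mk_sub_mk, sub_zero, zero_sub]
    exact hΨN _ (AddSubgroup.mem_sup_right (AddSubgroup.mem_map.2 ⟨v, hv, rfl⟩))
  · change Ψ (c, 0) + Ψ (0, c) ≠ 0
    rw [← map_add, Prod.mk_add_mk, add_zero, zero_add]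
    exact hΨc
  · have key : (Ψ.comp (AddMonoidHom.inl C C) - Ψ.comp (AddMonoidHom.inr C C)) (2 ^ f • b) ≠ 0 := by
      change Ψ (2 ^ f • b, 0) - Ψ (0, 2 ^ f • b) ≠ 0
      rw [← map_sub, Prod.mk_sub_mk, sub_zero, zero_sub, ← hβ]
      exact hΨb
    have := (addOrderOf_map_eq_iff_apply_bottom_ne_zero _ hbf).2 key
    rwa [AddMonoidHom.sub_apply] at this

end Relative

end Summit.BirchSwinnertonDyer.BirchSwinnertonDyer.Theorems.KolyvaginAdaptiveTwo
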